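import Mathlib
import Literature.MathematicalPhysics.QuantumFieldTheory.Balaban1983to89.B5Adjoint130

/-!
# B5: the adjoint vector averaging `Q*_k` of (1.69)–(1.84) and its momentum representation
# `\overline{u(p′+l)} \overline{v_μ(p′+l)}`

Source: T. Bałaban, *Propagators and renormalization transformations for lattice gauge
theories. I*, Commun. Math. Phys. 95 (1984) 17–40 (`Balaban1984PropagatorsI`, "B5"), renders
`b2b-balaban-ref1/pages/1984-cmp95-propagators-rt-I/…-pNNN-x2.png` (PDF page = journal page − 16),
read as images.

## What the paper prints (verbatim)

* p. 20 [PDF 4], (1.18): «(Q_kA)_b = Σ_{x∈B^k(b₋)} η^{d+1}A([x, x(b)]), b ⊂ T₁^{(k)} = ℤ^d ∩ T_η,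
  η = L^{−k}, (1.18) and x(b) is a point in B^k(b₊) obtained from x by translation by b. If
  b = ⟨y, y + e_μ⟩, then x(b) = x + e_μ.»
* p. 29 [PDF 13], (1.69): «⟨A, Δ_a A⟩ = ⟨A, ∂*∂A⟩ + ⟨A, ∂R∂*A⟩ + a⟨A, Q*QA⟩ = …»; p. 30 [PDF 14],
  (1.76): «φ = I + aQΔ⁻¹Q*»; p. 31 [PDF 15], (1.84): «φ_μ(p′) = 1 + aΣ_{l″}|u(p′+l″)|²|v_μ(p′+l″)|²
  /Δ(p′+l″) for p′ ≠ 0», with (1.61) «(Q̃A)_μ(p′) = Σ_l u(p′+l) v_μ(p′+l) Ã_μ(p′+l)» (p. 28).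

## What is typed and certified here (kernel-checked, zero sorry)

For the typed `Q_k = QvOp n M` of `B5Block118` (a matrix `T₁^{(k)} × {μ} ← T_η × {μ}`):
* `sum_ite_bpt` — the line/block indicator: `Σ_j [x = ny + j + s]·c = [y(x − s) = y]·c`;
* `QvOp_adjoint_mulVec` — the conjugate transpose: `((Q_k)ᴴ B)_μ(x) = η^{d+1} Σ_{t=0}^{n-1}
  B_μ(y(x − tηe_μ))` (the bonds `⟨x, x+e_μ⟩` of `T_η` lying on the straight lines of (1.18)
  through the block of `x − tηe_μ`);
* `dft_QvOp_adjoint` — ITS MOMENTUM REPRESENTATION: `((Q_k)ᴴ B)^_μ(p′+l) =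
  c · \overline{u(p′+l) v_μ(p′+l)} · B̂_μ(p′)`, `u = uSym`, `v = vSym` of `B5Prop11Fiber`, with the
  same constant `c = cQ = (√(n^d))⁻¹` as `Q_k`'s representation (1.61) (`B5Block118.dft_QvOp`);
  hence (in B5's normalisation, `c = 1`) `Q Δ⁻¹ Q*` acts on `B̂_μ(p′)` by the multiplier
  `Σ_l |u(p′+l)|²|v_μ(p′+l)|²/Δ(p′+l)` — the sum printed in (1.84)/(1.83) — once `Δ⁻¹` is the
  multiplier `1/Δ(p′+l)`; that last composition is NOT carried out here.

## What is NOT certified here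

B5's `Q*` is the adjoint for the `η^d`-weighted pairings (a scalar factor relative to `(Q_k)ᴴ`,
pairings not typed); the composition `QΔ⁻¹Q*` and (1.76)–(1.84) at operator level (pass 5,
`B5Prop11Inverse`, certifies them at fiber level); fields complex.
-/

open scoped BigOperators Matrix ComplexConjugate
open Finset Complex

namespace Literature.MathematicalPhysics.QuantumFieldTheory.Balaban1983to89.B5Adjoint176

open Literature.MathematicalPhysics.QuantumFieldTheory.Balaban1983to89.B5Prop11Fiber
open Literature.MathematicalPhysics.QuantumFieldTheory.Balaban1983to89.B5Prop11Plancherel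
open Literature.MathematicalPhysics.QuantumFieldTheory.Balaban1983to89.B5Action121
open Literature.MathematicalPhysics.QuantumFieldTheory.Balaban1983to89.B5Block118
open Literature.MathematicalPhysics.QuantumFieldTheory.Balaban1983to89.B5Blocks16
open Literature.MathematicalPhysics.QuantumFieldTheory.Balaban1983to89.B5Adjoint130

noncomputable section

variable {d : ℕ} (n : ℕ) [NeZero n] (M : Fin d → ℕ) [hM : ∀ μ, NeZero (M μ)]

/-- the line/block indicator: for fixed `y`, `x`, `s`, exactly one offset `j ∈ {0,…,n-1}^d` has
`x = ny + j + s` if `x − s ∈ B^k(y)`, none otherwise. [folklore] -/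
theorem sum_ite_bpt (y : Tor M) (x s : Tor (fine n M)) (c : ℂ) :
    ∑ j : Fin d → Fin n, (if x = bpt n M y j + s then c else 0)
      = if B5Blocks16.blockOf n M (x - s) = y then c else 0 := by
  obtain ⟨⟨y₀, j₀⟩, h0⟩ := (bpt_bijective n M).2 (x - s)
  simp only at h0
  have hx : x = bpt n M y₀ j₀ + s := by rw [h0, sub_add_cancel]
  rw [← h0, B5Blocks16.blockOf_bpt, hx]
  by_cases h : y₀ = y
  · subst h
    rw [if_pos rfl, Finset.sum_eq_single j₀]
    · rw [if_pos rfl]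
    · intro j _ hj
      rw [if_neg]
      intro hb
      have hinj := bpt_injective n M (a₁ := (y₀, j₀)) (a₂ := (y₀, j)) (add_right_cancel hb)
      exact hj (Prod.ext_iff.mp hinj).2.symm
    · intro h1
      exact absurd (Finset.mem_univ j₀) h1
  · rw [if_neg h]
    refine Finset.sum_eq_zero fun j _ => ?_
    rw [if_neg]
    intro hb
    have hinj := bpt_injective n M (a₁ := (y₀, j₀)) (a₂ := (y, j)) (add_right_cancel hb)
    exact h (Prod.ext_iff.mp hinj).1

/-- the conjugate transpose of `Q_k`: `((Q_k)ᴴ B)_μ(x) = η^{d+1} Σ_{t=0}^{n-1} B_μ(y(x − tηe_μ))`.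
[cite: Balaban1984PropagatorsI, (1.18) p.20] -/
theorem QvOp_adjoint_mulVec (B : Tor M × Fin d → ℂ) (x : Tor (fine n M)) (κ : Fin d) :
    ((QvOp n M)ᴴ *ᵥ B) (x, κ)
      = 1 / (n : ℂ) ^ (d + 1) *
          ∑ t : Fin n, B (B5Blocks16.blockOf n M (x - tstep (fine n M) κ t), κ) := by
  have hc : star (1 / (n : ℂ) ^ (d + 1)) = 1 / (n : ℂ) ^ (d + 1) := by
    rw [Complex.star_def, map_div₀, map_one, map_pow, Complex.conj_natCast]
  have hs : ∀ (P : Prop) [Decidable P] (a : ℂ),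
      star (if P then a else 0) = if P then star a else 0 := by
    intro P _ a
    split_ifs <;> simp
  have hentry : ∀ b : Tor M × Fin d, (QvOp n M)ᴴ (x, κ) b
      = if κ = b.2 then ∑ t : Fin n,
          (if B5Blocks16.blockOf n M (x - tstep (fine n M) b.2 t) = b.1
            then 1 / (n : ℂ) ^ (d + 1) else 0)
        else 0 := by
    intro b
    rw [Matrix.conjTranspose_apply]
    unfold QvOp
    simp only [hs, star_sum, hc]
    split_ifs with h
    · rw [Finset.sum_comm]
      refine Finset.sum_congr rfl fun t _ => ?_
      exact sum_ite_bpt n M b.1 x (tstep (fine n M) b.2 t) _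
    · rfl
  simp only [Matrix.mulVec, dotProduct, hentry]
  rw [Fintype.sum_prod_type]
  simp only [ite_mul, zero_mul, Finset.sum_ite_eq, Finset.mem_univ, if_true, Finset.sum_mul]
  rw [Finset.sum_comm, Finset.mul_sum]
  refine Finset.sum_congr rfl fun t _ => ?_
  rw [Finset.sum_ite_eq, if_pos (Finset.mem_univ _)]

/-- THE MOMENTUM REPRESENTATION OF `Q*_k`: `((Q_k)ᴴ B)^_μ(p′+l) = c·\overline{u(p′+l) v_μ(p′+l)}·B̂_μ(p′)`
(`u = uSym`, `v = vSym`, `c = cQ = (√(n^d))⁻¹` as in (1.61) `dft_QvOp`); with (1.61) this gives the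
multiplier `Σ_l |u(p′+l)|²|v_μ(p′+l)|²/Δ(p′+l)` of `QΔ⁻¹Q*` printed in (1.84)/(1.83).
[cite: Balaban1984PropagatorsI, (1.76) p.30, (1.84) p.31] -/
theorem dft_QvOp_adjoint (B : Tor M × Fin d → ℂ) (k : Fin d → Fin n) (q : Tor M) (κ : Fin d) :
    (dft (fine n M) *ᵥ comp (fine n M) ((QvOp n M)ᴴ *ᵥ B) κ) (pOf n M (k, q))
      = (cQ n M : ℂ) * conj (uSym n k (sOf M q) * vSym n k (sOf M q) κ)
          * (dft M *ᵥ comp M B κ) q := by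
  have hnc : (n : ℂ) ≠ 0 := by exact_mod_cast NeZero.ne n
  have h1 : comp (fine n M) ((QvOp n M)ᴴ *ᵥ B) κ
      = fun x => 1 / (n : ℂ) ^ (d + 1) *
          ∑ t : Fin n, B (B5Blocks16.blockOf n M (x - tstep (fine n M) κ t), κ) :=
    funext fun x => QvOp_adjoint_mulVec n M B x κ
  have h2 : ∀ t : ℕ,
      ∑ x, dft (fine n M) (pOf n M (k, q)) x *
          B (B5Blocks16.blockOf n M (x - tstep (fine n M) κ t), κ)
        = conj (chi (fine n M) (pOf n M (k, q)) (tstep (fine n M) κ t)) *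
          ∑ x, dft (fine n M) (pOf n M (k, q)) x * B (B5Blocks16.blockOf n M x, κ) := by
    intro t
    rw [← Fintype.sum_equiv (Equiv.addRight (tstep (fine n M) κ t))
      (fun z => dft (fine n M) (pOf n M (k, q)) (z + tstep (fine n M) κ t) *
        B (B5Blocks16.blockOf n M z, κ))
      (fun x => dft (fine n M) (pOf n M (k, q)) x *
        B (B5Blocks16.blockOf n M (x - tstep (fine n M) κ t), κ))
      (fun z => by simp only [Equiv.coe_addRight, add_sub_cancel_right])]
    rw [Finset.mul_sum]
    refine Finset.sum_congr rfl fun z _ => ?_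
    rw [dft_apply', dft_apply', chi_add_right, map_mul]
    ring
  have h3 : ∑ x, dft (fine n M) (pOf n M (k, q)) x * B (B5Blocks16.blockOf n M x, κ)
      = (cQ n M : ℂ) * (n : ℂ) ^ d * conj (uSym n k (sOf M q)) * (dft M *ᵥ comp M B κ) q := by
    rw [← dft_blockConst n M (comp M B κ) k q]
    rfl
  have h4 : ∑ t : Fin n, conj (chi (fine n M) (pOf n M (k, q)) (tstep (fine n M) κ t))
      = (n : ℂ) * conj (vSym n k (sOf M q) κ) := by
    rw [← map_sum]
    simp_rw [chi_pOf_tstep]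
    rw [avg_om, map_mul, Complex.conj_natCast]
  rw [h1]
  calc (dft (fine n M) *ᵥ fun x => 1 / (n : ℂ) ^ (d + 1) *
          ∑ t : Fin n, B (B5Blocks16.blockOf n M (x - tstep (fine n M) κ t), κ)) (pOf n M (k, q))
      = 1 / (n : ℂ) ^ (d + 1) * ∑ t : Fin n, ∑ x, dft (fine n M) (pOf n M (k, q)) x *
          B (B5Blocks16.blockOf n M (x - tstep (fine n M) κ t), κ) := by
        simp only [Matrix.mulVec, dotProduct, Finset.mul_sum]
        rw [Finset.sum_comm]
        exact Finset.sum_congr rfl fun t _ => Finset.sum_congr rfl fun x _ => by ring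
    _ = 1 / (n : ℂ) ^ (d + 1) * ∑ t : Fin n,
          conj (chi (fine n M) (pOf n M (k, q)) (tstep (fine n M) κ t)) *
            ((cQ n M : ℂ) * (n : ℂ) ^ d * conj (uSym n k (sOf M q)) * (dft M *ᵥ comp M B κ) q) := by
        congr 1
        refine Finset.sum_congr rfl fun t _ => ?_
        rw [h2, h3]
    _ = (cQ n M : ℂ) * conj (uSym n k (sOf M q) * vSym n k (sOf M q) κ)
          * (dft M *ᵥ comp M B κ) q := by
        rw [← Finset.sum_mul, h4, map_mul]
        field_simp
        ring

end

end Literature.MathematicalPhysics.QuantumFieldTheory.Balaban1983to89.B5Adjoint176
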